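import Literature.Computability.Complexity.BakerGillSolovay
import Literature.Computability.Complexity.BrainProtocol
import HarnessLib

/-!
# A one-string-per-length oracle `G` with `L_G ∈ UP ∩ coUP` but `L_G ∉ P^{K ⊕ G}` (Fortnow–Rogers 1999, proof of Thm. 4.2, first half)

Topic `Computability/Complexity`. Fortnow–Rogers (JCSS 1999, Thm. 4.2: an oracle `C` with
`P^C = BPP^C = BQP^C ≠ UP^C ∩ coUP^C`) take `C = H ⊕ G` with `G` a `UP ∩ coUP`-generic oracle —
"which must have exactly one string at lengths that are exponentially far apart" — and show first
that `P^C ≠ UP^C ∩ coUP^C`: "Let `L^X = {0ⁿ | (∃x) |x| = n − 1 & x0 ∈ X}`. It's easy to see that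
`L^G ∈ UP^G ∩ coUP^G` … A simple diagonalization argument demonstrates that `L^G ∉ P^G`. Because `G`
is generic with respect to `H`, `L^C ∉ P^C`" (p. 7). This file carries out that diagonalization in
the tree's transcript model of `P^O` (`PRel`, `Complexity/Oracle.lean`), for an ARBITRARY fixed
language `K` in place of the `PSPACE`-complete `H` (the tree's proof of `P^C = BQP^C` uses a
self-encoding `K`, `QuantumComplexity/FortnowRogersBrain.lean`), and with `G` holding exactly one
string of EVERY positive length (the sparsity of the acceptable lengths is needed in print only
for the brute-force part of the simulation, which the tree's simulation does not use):

* `testLang G = {x | ∃ w, |w| = |x| ∧ 1w ∈ G}` — "the `G`-string of length `|x| + 1` starts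
  with `1`" (the printed `L^G` with the marked bit in front and all inputs of a length alike);
* the stages `UPDiag.stage K d i` against an enumeration `d` of (oracle algorithm, polynomial)
  pairs, following the tree's Baker–Gill–Solovay file (`BGS.lvl`, freezing bounds): at stage `i`
  a fresh length `n + 1` (`n > Nᵢ`, `qᵢ(n) < 2ⁿ`) receives the string `b w`, `|w| = n`, where
  `1 b w` was not queried by the run of `Mᵢ` on `1ⁿ` against `K ⊕ (current G without length n + 1)`
  and `b` contradicts the run's answer; every other positive length holds the default string `0^ℓ`
  (`fill`); `oracleG K d` is the limit;
* `existsUnique_mem_oracleG` — exactly one string of each positive length, none of length `0`;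
* `testLang_oracleG_not_mem_PRel` — `testLang G ∉ P^{K ⊕ G}` when `d` lists every
  polynomial-time pair (the final oracle answers the stage queries as the stage oracle did:
  `joinLang_oracleG_apply_of_mem_stQs`);
* `vLang b A ∈ P^A` (`vLang_mem_PRel`, one truth-table query) with
  `⟨x, w⟩ ∈ vLang b (K ⊕ G) ↔ |w| = |x| ∧ b w ∈ G` — the verifiers making `testLang G` a
  `UP^{K ⊕ G} ∩ coUP^{K ⊕ G}` language when `G` has one string per positive length
  (`existsUnique_witness`); the classes `UP^O`, `coUP^O` themselves live in the barrier file
  `Literature/Barriers/QuantumAdvantage/SupremacyTheoremsNonRelativizing.lean`, which consumes these.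
* `exists_oracleG` — the packaged existence statement over `BGS.exists_enum_pair`.

## References

* [FortnowRogers1999JCSS] L. Fortnow, J. Rogers, *Complexity limitations on quantum
  computation*, JCSS 59 (1999) 240–252 (arXiv:cs/9811023): §2.6 (p. 4, `UP ∩ coUP`-conditions:
  "exactly one string at each acceptable length"), Thm. 4.2 and its proof (p. 7).
* [AroraBarakCC2009] S. Arora, B. Barak, *Computational Complexity*, CUP 2009, Thm. 3.7 (the
  diagonalization `U_B ∉ P^B`).
* [Ko1989] K.-I Ko, *Constructing oracles by lower bound techniques for circuits*, 1989, §3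
  (stage construction with freezing bounds `t(n)`).
-/

namespace Literature.Computability.Complexity

open _root_.Computability Polynomial BrainProtocol

namespace UPDiag

/-! ### The test language and the verifiers -/

/-- **The test language of `G`**: the inputs `x` such that the string of `G` of length `|x| + 1`
(unique, for the oracles built here) starts with `1` — Fortnow–Rogers' `L^G` with the marked bit
in front. [cite: FortnowRogers1999JCSS, proof of Thm. 4.2 (p. 7)] -/
def testLang (G : Set (List Bool)) : Set (List Bool) :=
  {x | ∃ w : List Bool, w.length = x.length ∧ true :: w ∈ G}

/-- The query of the verifier: from `⟨⟨x, w⟩, answers⟩` ask `1 b w`. [folklore] -/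
def vQry (b : Bool) : List Bool → List Bool := List.cons true ∘ List.cons b ∘ sndP ∘ fstP

/-- `vQry b ∈ FP`. [folklore] -/
theorem vQry_mem_FP (b : Bool) : vQry b ∈ FP :=
  comp_mem_FP (cons_mem_FP true) (comp_mem_FP (cons_mem_FP b) (comp_mem_FP sndP_mem_FP fstP_mem_FP))

/-- Pairs of strings of equal length: `⟨x, w⟩` with `|w| ≤ |x|` and `|x| ≤ |w|`. [folklore] -/
noncomputable def EqLen : Language Bool := LenLe X ⊓ (fanoutFn sndP fstP ⁻¹' LenLe X)

/-- `EqLen ∈ P`. [folklore] -/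
theorem EqLen_mem_P : EqLen ∈ Classes.P :=
  inter_mem_P (LenLe_mem_P X) (preimage_mem_P (LenLe_mem_P X) (fanoutFn_mem_FP sndP_mem_FP fstP_mem_FP))

/-- Membership of a pair in `EqLen`. [folklore] -/
@[simp] theorem boolPair_mem_EqLen (x w : List Bool) : boolPair x w ∈ EqLen ↔ w.length = x.length := by
  change boolPair x w ∈ LenLe X ∧ fanoutFn sndP fstP (boolPair x w) ∈ LenLe X ↔ _
  rw [fanoutFn_apply, sndP_boolPair, fstP_boolPair, boolPair_mem_LenLe, boolPair_mem_LenLe, eval_X, eval_X]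
  omega

/-- The evaluator of the verifier: the pair has equal lengths and the (single) answer bit is `1`.
[folklore] -/
noncomputable def vDec : Language Bool := (fstP ⁻¹' EqLen) ⊓ (sndP ⁻¹' TTClosure.HasBit true)

/-- `vDec ∈ P`. [folklore] -/
theorem vDec_mem_P : vDec ∈ Classes.P :=
  inter_mem_P (preimage_mem_P EqLen_mem_P fstP_mem_FP) (preimage_mem_P (TTClosure.HasBit_mem_P true) sndP_mem_FP)

/-- **The verifier language** `vLang b A`: one truth-table query `1 b w` to `A` on input `⟨x, w⟩`,
accept iff `|w| = |x|` and the answer is yes. [cite: FortnowRogers1999JCSS, proof of Thm. 4.2 (L^G ∈ UP^G ∩ coUP^G)] -/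
noncomputable def vLang (b : Bool) (A : Set (List Bool)) : Language Bool :=
  ttLang (vQry b) 1 vDec A

/-- **`vLang b A ∈ P^A`.** [cite: LadnerLynchSelman1975, §3] -/
theorem vLang_mem_PRel (b : Bool) (A : Set (List Bool)) : vLang b A ∈ PRel (Oracle.ofLanguage A) :=
  ttLang_mem_PRel (vQry_mem_FP b) vDec_mem_P A

/-- **Semantics of the verifier**: `⟨x, w⟩ ∈ vLang b A ↔ |w| = |x| ∧ 1 b w ∈ A`. [folklore] -/
theorem boolPair_mem_vLang {b : Bool} {A : Set (List Bool)} {x w : List Bool} :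
    boolPair x w ∈ vLang b A ↔ w.length = x.length ∧ true :: b :: w ∈ A := by
  rw [vLang, mem_ttLang_iff]
  have h1 : ttBits (vQry b) A (boolPair x w) ((1 : Polynomial ℕ).eval (boolPair x w).length) =
      [A.boolIndicator (true :: b :: w)] := by
    rw [eval_one]
    simp [ttBits, vQry]
  rw [h1]
  change fstP (boolPair (boolPair x w) [A.boolIndicator (true :: b :: w)]) ∈ EqLen ∧
    sndP (boolPair (boolPair x w) [A.boolIndicator (true :: b :: w)]) ∈ TTClosure.HasBit true ↔ _
  rw [fstP_boolPair, sndP_boolPair, boolPair_mem_EqLen, TTClosure.mem_HasBit, List.mem_singleton]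
  constructor
  · rintro ⟨h, h'⟩
    exact ⟨h, (Set.mem_iff_boolIndicator _ _).2 h'.symm⟩
  · rintro ⟨h, h'⟩
    exact ⟨h, ((Set.mem_iff_boolIndicator _ _).1 h').symm⟩

/-- The verifier relative to `K ⊕ G` checks `b w ∈ G`. [cite: FortnowRogers1999JCSS, proof of Thm. 4.2 (p. 7)] -/
theorem boolPair_mem_vLang_joinLang {b : Bool} {K G : Set (List Bool)} {x w : List Bool} :
    boolPair x w ∈ vLang b (joinLang K G) ↔ w.length = x.length ∧ b :: w ∈ G := by
  rw [boolPair_mem_vLang, true_cons_mem_joinLang]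

/-- **Unique witnesses.** If `G` has exactly one string of every positive length then for every
`x` exactly one pair `(b, w)` with `|w| = |x|` has `b w ∈ G`; so the `vLang 1`-witnesses of `x`
(resp. the `vLang 0`-witnesses) form a subsingleton, and `x ∈ testLang G` iff a `1`-witness
exists iff no `0`-witness exists. [cite: FortnowRogers1999JCSS, §2.6 (p. 4) and proof of Thm. 4.2 (p. 7)] -/
theorem existsUnique_witness {G : Set (List Bool)} (hG : ∀ n, 0 < n → ∃! z, z ∈ G ∧ z.length = n)
    (x : List Bool) :
    (∀ b : Bool, {w : List Bool | w.length = x.length ∧ b :: w ∈ G}.Subsingleton) ∧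
      (x ∈ testLang G ↔ ¬ ∃ w : List Bool, w.length = x.length ∧ false :: w ∈ G) := by
  obtain ⟨z, ⟨hzG, hzl⟩, huniq⟩ := hG (x.length + 1) (Nat.succ_pos _)
  have key : ∀ (b : Bool) (w : List Bool), w.length = x.length → b :: w ∈ G → b :: w = z :=
    fun b w hw hbw => huniq (b :: w) ⟨hbw, by simp [hw]⟩
  refine ⟨fun b w hw w' hw' => ?_, ⟨?_, ?_⟩⟩
  · have h1 := key b w hw.1 hw.2
    have h2 := key b w' hw'.1 hw'.2
    exact List.tail_eq_of_cons_eq (h1.trans h2.symm)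
  · rintro ⟨w, hw, hwG⟩ ⟨w', hw', hw'G⟩
    have := (key true w hw hwG).trans (key false w' hw' hw'G).symm
    cases this
  · intro h
    -- the unique string of length `|x| + 1` is `b :: w`; it is not a `0`-witness, so `b = 1`
    obtain ⟨b, w, rfl⟩ : ∃ b w, z = b :: w := by
      cases z with
      | nil => simp at hzl
      | cons b w => exact ⟨b, w, rfl⟩
    have hw : w.length = x.length := by simpa using hzl
    cases b with
    | false => exact absurd ⟨w, hw, hzG⟩ h
    | true => exact ⟨w, hw, hzG⟩

/-! ### Defaults and filling -/

/-- The default strings `0^ℓ`, `ℓ ≥ 1`. [cite: FortnowRogers1999JCSS, §2.6 (p. 4: "the value 0 for every string not at an acceptable length")] -/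
def IsDefault (z : List Bool) : Prop := z ≠ [] ∧ ∀ b ∈ z, b = false

/-- `0^ℓ` is the default string of length `ℓ ≥ 1`. [folklore] -/
theorem isDefault_replicate {ℓ : ℕ} (h : 0 < ℓ) : IsDefault (List.replicate ℓ false) :=
  ⟨by cases ℓ <;> simp at h ⊢, fun b hb => (List.eq_of_mem_replicate hb)⟩

/-- A default string is `0^{|z|}`. [folklore] -/
theorem IsDefault.eq_replicate {z : List Bool} (h : IsDefault z) : z = List.replicate z.length false :=
  List.eq_replicate_iff.2 ⟨rfl, h.2⟩

/-- **Filling**: the chosen strings `B` together with the default string at every positive length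
holding no chosen string. [cite: FortnowRogers1999JCSS, §2.6 (p. 4)] -/
def fill (B : Set (List Bool)) : Set (List Bool) :=
  B ∪ {z | IsDefault z ∧ ∀ s ∈ B, s.length ≠ z.length}

/-- Membership in a filling. [folklore] -/
theorem mem_fill_iff {B : Set (List Bool)} {z : List Bool} :
    z ∈ fill B ↔ z ∈ B ∨ (IsDefault z ∧ ∀ s ∈ B, s.length ≠ z.length) :=
  Iff.rfl

/-- **One string per positive length**: if the chosen strings are nonempty strings of pairwise
distinct lengths then the filling has exactly one string of every positive length and none of
length `0`. [cite: FortnowRogers1999JCSS, §2.6 (p. 4)] -/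
theorem existsUnique_mem_fill {B : Set (List Bool)} (hne : ∀ s ∈ B, s ≠ [])
    (hlen : ∀ s ∈ B, ∀ s' ∈ B, s.length = s'.length → s = s') :
    (∀ n, 0 < n → ∃! z, z ∈ fill B ∧ z.length = n) ∧ ([] : List Bool) ∉ fill B := by
  refine ⟨fun n hn => ?_, ?_⟩
  · by_cases hex : ∃ s ∈ B, s.length = n
    · obtain ⟨s, hs, hsl⟩ := hex
      refine ⟨s, ⟨Or.inl hs, hsl⟩, fun z ⟨hz, hzl⟩ => ?_⟩
      rcases hz with hz | ⟨-, hz⟩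
      · exact hlen z hz s hs (hzl.trans hsl.symm)
      · exact absurd (hsl.trans hzl.symm) (hz s hs)
    · push Not at hex
      refine ⟨List.replicate n false, ⟨Or.inr ⟨isDefault_replicate hn, fun s hs => ?_⟩, by simp⟩,
        fun z ⟨hz, hzl⟩ => ?_⟩
      · rw [List.length_replicate]; exact hex s hs
      · rcases hz with hz | ⟨hz, -⟩
        · exact absurd hzl (hex z hz)
        · rw [hz.eq_replicate, hzl]
  · rintro (h | ⟨⟨h, -⟩, -⟩)
    · exact hne [] h rfl
    · exact h rfl

/-! ### The stages -/

/-- A `1 b w`, `|w| = n`, outside the list `Q`, when `|Q| < 2ⁿ` (junk `[]` otherwise): the head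
bit `b` followed by the unqueried tail. [cite: AroraBarakCC2009, Thm. 3.7 (proof)] -/
noncomputable def pick (b : Bool) (n : ℕ) (Q : List (List Bool)) : List Bool :=
  open scoped Classical in
  if h : ∃ w : List Bool, w.length = n ∧ true :: b :: w ∉ Q then b :: Classical.choose h else []

/-- Fewer than `2ⁿ` queries miss some `1 b w` with `|w| = n`. [cite: AroraBarakCC2009, Thm. 3.7 (proof)] -/
theorem exists_unqueried (b : Bool) (n : ℕ) (Q : List (List Bool)) (hQ : Q.length < 2 ^ n) :
    ∃ w : List Bool, w.length = n ∧ true :: b :: w ∉ Q := by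
  classical
  by_contra hne
  push Not at hne
  let f : List.Vector Bool n → List Bool := fun v => true :: b :: v.1
  have hf : Function.Injective f := by
    intro v w hvw
    simp only [f, List.cons.injEq, true_and] at hvw
    exact List.Vector.ext_iff.2 fun i => by simp [List.Vector.get, hvw]
  have hsub : (Finset.univ.image f) ⊆ Q.toFinset := by
    intro z hz
    obtain ⟨v, -, rfl⟩ := Finset.mem_image.1 hz
    exact List.mem_toFinset.2 (hne v.1 v.2)
  have hcard : (Finset.univ.image f).card = 2 ^ n := by
    rw [Finset.card_image_of_injective _ hf, Finset.card_univ, card_vector, Fintype.card_bool]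
  have := (Finset.card_le_card hsub).trans (List.toFinset_card_le Q)
  omega

/-- Specification of `pick`. [cite: AroraBarakCC2009, Thm. 3.7 (proof)] -/
theorem pick_spec (b : Bool) {n : ℕ} {Q : List (List Bool)} (hQ : Q.length < 2 ^ n) :
    ∃ w : List Bool, w.length = n ∧ pick b n Q = b :: w ∧ true :: b :: w ∉ Q := by
  classical
  have h := exists_unqueried b n Q hQ
  refine ⟨Classical.choose h, (Classical.choose_spec h).1, ?_, (Classical.choose_spec h).2⟩
  rw [pick, dif_pos h]

/-- The state after a number of stages: the chosen strings and the frozen bound `N` (membership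
of every string of length `≤ N` in the final `G` is decided). [cite: Ko1989, §3 (pp. 10–11)] -/
structure St where
  /-- strings chosen so far (one per diagonalization length) -/
  B : Finset (List Bool)
  /-- all lengths `≤ N` are frozen -/
  N : ℕ

variable (K : Set (List Bool)) (D : OracleAlg Bool × Polynomial ℕ) (s : St)

/-- The input length `n` of the stage: fresh (`> N`) with `q(n) < 2ⁿ`; the new string gets length
`n + 1`. [cite: Ko1989, §3 (p. 10)] -/
noncomputable def stLvl : ℕ := BGS.lvl D.2 s.N

/-- The probe half of the stage oracle: the current filling with the fresh length `n + 1`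
emptied. [cite: FortnowRogers1999JCSS, proof of Thm. 4.2 (p. 7: "under the assumption that there are no strings of length ℓ in G")] -/
def stG : Set (List Bool) := {z | z ∈ fill (↑s.B : Set (List Bool)) ∧ z.length ≠ stLvl D s + 1}

/-- The stage run: the algorithm on `1ⁿ` for `q(n)` rounds against `K ⊕ stG`.
[cite: AroraBarakCC2009, Thm. 3.7 (proof, stage i)] -/
noncomputable def stRes : Option Bool :=
  D.1.run (Oracle.ofLanguage (joinLang K (stG D s))) (D.2.eval (stLvl D s)) (ones (stLvl D s))

/-- The queries of the stage run. [cite: AroraBarakCC2009, Thm. 3.7 (proof, stage i)] -/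
noncomputable def stQs : List (List Bool) :=
  D.1.queries (Oracle.ofLanguage (joinLang K (stG D s))) (D.2.eval (stLvl D s)) (ones (stLvl D s))

/-- The head bit of the new string: `0` if the run accepted, `1` otherwise (contradicting it).
[cite: FortnowRogers1999JCSS, proof of Thm. 4.2 (p. 7: "a simple diagonalization argument")] -/
noncomputable def stBit : Bool := !decide (stRes K D s = some true)

/-- The new string `b w`, `|w| = n`, with `1 b w` unqueried. [cite: AroraBarakCC2009, Thm. 3.7 (proof)] -/
noncomputable def stAdd : List Bool := pick (stBit K D s) (stLvl D s) (stQs K D s)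

/-- **One stage**, followed by freezing every query made and the length `n + 1`.
[cite: AroraBarakCC2009, Thm. 3.7 (proof)] [cite: Ko1989, §3 (pp. 10–11)] -/
noncomputable def next : St where
  B := insert (stAdd K D s) s.B
  N := stLvl D s + 1 + ((stQs K D s).map List.length).sum

variable (d : ℕ → OracleAlg Bool × Polynomial ℕ)

/-- The stages against the enumeration `d`. [cite: AroraBarakCC2009, Thm. 3.7 (proof)] -/
noncomputable def stage : ℕ → St
  | 0 => ⟨∅, 0⟩
  | i + 1 => next K (d i) (stage i)

/-- The chosen strings of all stages. [cite: Ko1989, §3 (p. 11)] -/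
def chosen : Set (List Bool) := {s | ∃ i, s ∈ (stage K d i).B}

/-- **The diagonal oracle `G`**: the chosen strings, filled with defaults. [cite: FortnowRogers1999JCSS, proof of Thm. 4.2 (p. 7)] -/
def oracleG : Set (List Bool) := fill (chosen K d)

/-- The input length of stage `i`. [cite: Ko1989, §3 (p. 10)] -/
noncomputable def lv (i : ℕ) : ℕ := stLvl (d i) (stage K d i)

/-- Stage `i + 1` unfolds to `next`. [folklore] -/
theorem stage_succ (i : ℕ) : stage K d (i + 1) = next K (d i) (stage K d i) := rfl

/-- The frozen bound is below the stage length. [cite: Ko1989, §3 (p. 10)] -/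
theorem N_lt_lv (i : ℕ) : (stage K d i).N < lv K d i := BGS.lt_lvl _ _

/-- The next frozen bound covers the new length `n + 1`. [cite: Ko1989, §3 (p. 11)] -/
theorem lv_lt_N_succ (i : ℕ) : lv K d i + 1 ≤ (stage K d (i + 1)).N := by
  rw [stage_succ]; change lv K d i + 1 ≤ lv K d i + 1 + _; omega

/-- The next frozen bound covers every query of the stage run. [cite: Ko1989, §3 (p. 11)] -/
theorem length_le_N_succ_of_mem_stQs (i : ℕ) {y : List Bool} (hy : y ∈ stQs K (d i) (stage K d i)) :
    y.length ≤ (stage K d (i + 1)).N := by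
  rw [stage_succ]
  change y.length ≤ lv K d i + 1 + ((stQs K (d i) (stage K d i)).map List.length).sum
  have : y.length ≤ ((stQs K (d i) (stage K d i)).map List.length).sum :=
    List.single_le_sum (fun _ _ => Nat.zero_le _) _ (List.mem_map.2 ⟨y, hy, rfl⟩)
  omega

/-- The frozen bounds increase. [cite: Ko1989, §3 (p. 11)] -/
theorem N_le_N_succ (i : ℕ) : (stage K d i).N ≤ (stage K d (i + 1)).N :=
  ((N_lt_lv K d i).le.trans (Nat.le_succ _)).trans (lv_lt_N_succ K d i)

/-- The frozen bounds are monotone. [cite: Ko1989, §3 (p. 11)] -/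
theorem N_mono {i j : ℕ} (h : i ≤ j) : (stage K d i).N ≤ (stage K d j).N := by
  induction h with
  | refl => exact le_rfl
  | step _ ih => exact ih.trans (N_le_N_succ K d _)

/-- The stage lengths increase. [cite: Ko1989, §3 (p. 10)] -/
theorem lv_strictMono {i j : ℕ} (h : i < j) : lv K d i + 1 < lv K d j :=
  lt_of_le_of_lt ((lv_lt_N_succ K d i).trans (N_mono K d h)) (N_lt_lv K d j)

/-- The stage run makes fewer than `2ⁿ` queries. [cite: AroraBarakCC2009, Thm. 3.7 (proof)] -/
theorem length_stQs_lt (i : ℕ) : (stQs K (d i) (stage K d i)).length < 2 ^ lv K d i :=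
  lt_of_le_of_lt ((d i).1.length_queries_le _ _ _) (BGS.eval_lvl_lt _ _)

/-- **The new string of stage `i`**: `b w` with `|w| = n`, `1 b w` unqueried, `b` the
contradicting bit. [cite: AroraBarakCC2009, Thm. 3.7 (proof)] -/
theorem stAdd_spec (i : ℕ) :
    ∃ w : List Bool, w.length = lv K d i ∧
      stAdd K (d i) (stage K d i) = stBit K (d i) (stage K d i) :: w ∧
        true :: stBit K (d i) (stage K d i) :: w ∉ stQs K (d i) (stage K d i) :=
  pick_spec _ (length_stQs_lt K d i)

/-- The new string of stage `i` has length `n + 1`. [folklore] -/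
theorem length_stAdd (i : ℕ) : (stAdd K (d i) (stage K d i)).length = lv K d i + 1 := by
  obtain ⟨w, hw, h, -⟩ := stAdd_spec K d i
  rw [h, List.length_cons, hw]

/-- Membership in the next stage. [folklore] -/
theorem mem_stage_succ_iff (i : ℕ) (s : List Bool) :
    s ∈ (stage K d (i + 1)).B ↔ s ∈ (stage K d i).B ∨ s = stAdd K (d i) (stage K d i) := by
  rw [stage_succ]
  change s ∈ insert _ _ ↔ _
  rw [Finset.mem_insert]; tauto

/-- The stages are cumulative. [cite: Ko1989, §3 (p. 11)] -/
theorem B_mono {i j : ℕ} (h : i ≤ j) : (stage K d i).B ⊆ (stage K d j).B := by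
  induction h with
  | refl => exact Finset.Subset.refl _
  | step _ ih => exact ih.trans fun s hs => (mem_stage_succ_iff K d _ s).2 (Or.inl hs)

/-- Every chosen string of stage `i` has length at most the frozen bound `Nᵢ`, and at least `2`.
[cite: Ko1989, §3 (p. 11)] -/
theorem length_le_N_of_mem {i : ℕ} {s : List Bool} (hs : s ∈ (stage K d i).B) :
    2 ≤ s.length ∧ s.length ≤ (stage K d i).N := by
  induction i with
  | zero => exact absurd hs (Finset.notMem_empty s)
  | succ i ih =>
    rcases (mem_stage_succ_iff K d i s).1 hs with h | rfl
    · exact ⟨(ih h).1, (ih h).2.trans (N_le_N_succ K d i)⟩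
    · rw [length_stAdd]
      exact ⟨by have := N_lt_lv K d i; omega, lv_lt_N_succ K d i⟩

/-- **Freezing**: a string of length `≤ Nᵢ₊₁` belongs to a later stage iff it belongs to stage
`i + 1`. [cite: Ko1989, §3 (p. 11)] -/
theorem mem_stage_iff_of_le {i : ℕ} {s : List Bool} (hs : s.length ≤ (stage K d (i + 1)).N) :
    ∀ {j : ℕ}, i + 1 ≤ j → (s ∈ (stage K d j).B ↔ s ∈ (stage K d (i + 1)).B) := by
  intro j hj
  induction hj with
  | refl => exact Iff.rfl
  | @step j hij ih =>
    rw [← ih, mem_stage_succ_iff]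
    constructor
    · rintro (h | h)
      · exact h
      · exfalso
        have h1 := length_stAdd K d j
        have h2 := N_lt_lv K d j
        have h3 := N_mono K d hij
        rw [← h] at h1
        omega
    · exact Or.inl

/-- **Freezing for the limit**: a string of length `≤ Nᵢ₊₁` is chosen iff it is in stage `i + 1`.
[cite: Ko1989, §3 (p. 11)] -/
theorem mem_chosen_iff_of_le {i : ℕ} {s : List Bool} (hs : s.length ≤ (stage K d (i + 1)).N) :
    s ∈ chosen K d ↔ s ∈ (stage K d (i + 1)).B := by
  constructor
  · rintro ⟨j, hj⟩
    rcases le_total (i + 1) j with hij | hji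
    · exact (mem_stage_iff_of_le K d hs hij).1 hj
    · exact B_mono K d hji hj
  · exact fun h => ⟨i + 1, h⟩

/-- Chosen strings are nonempty and have pairwise distinct lengths. [cite: FortnowRogers1999JCSS, §2.6 (p. 4)] -/
theorem chosen_spec :
    (∀ s ∈ chosen K d, s ≠ []) ∧ ∀ s ∈ chosen K d, ∀ s' ∈ chosen K d, s.length = s'.length → s = s' := by
  -- the strings of stage `i` are the `stAdd j`, `j < i`, of lengths `lv j + 1`
  have key : ∀ (i : ℕ) (s : List Bool), s ∈ (stage K d i).B → ∃ j < i, s = stAdd K (d j) (stage K d j) := by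
    intro i
    induction i with
    | zero => intro s hs; exact absurd hs (Finset.notMem_empty s)
    | succ i ih =>
      intro s hs
      rcases (mem_stage_succ_iff K d i s).1 hs with h | rfl
      · obtain ⟨j, hj, rfl⟩ := ih s h
        exact ⟨j, Nat.lt_succ_of_lt hj, rfl⟩
      · exact ⟨i, Nat.lt_succ_self i, rfl⟩
  refine ⟨fun s ⟨i, hs⟩ h => ?_, fun s ⟨i, hs⟩ s' ⟨i', hs'⟩ hl => ?_⟩
  · have := (length_le_N_of_mem K d hs).1
    rw [h] at this
    exact absurd this (by simp)
  · obtain ⟨j, -, rfl⟩ := key i s hs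
    obtain ⟨j', -, rfl⟩ := key i' s' hs'
    rw [length_stAdd, length_stAdd] at hl
    rcases lt_trichotomy j j' with h | rfl | h
    · have := lv_strictMono K d h; omega
    · rfl
    · have := lv_strictMono K d h; omega

/-- **`G` has exactly one string of every positive length, and none of length `0`.**
[cite: FortnowRogers1999JCSS, §2.6 (p. 4) and proof of Thm. 4.2 (p. 7)] -/
theorem existsUnique_mem_oracleG :
    (∀ n, 0 < n → ∃! z, z ∈ oracleG K d ∧ z.length = n) ∧ ([] : List Bool) ∉ oracleG K d :=
  existsUnique_mem_fill (chosen_spec K d).1 (chosen_spec K d).2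

/-- At the fresh length `lvᵢ + 1` the only string of `G` is the new string of stage `i`. [cite: FortnowRogers1999JCSS, proof of Thm. 4.2 (p. 7)] -/
theorem eq_stAdd_of_mem_oracleG {i : ℕ} {z : List Bool} (hz : z ∈ oracleG K d) (hl : z.length = lv K d i + 1) :
    z = stAdd K (d i) (stage K d i) := by
  have hmem : stAdd K (d i) (stage K d i) ∈ oracleG K d :=
    Or.inl ⟨i + 1, (mem_stage_succ_iff K d i _).2 (Or.inr rfl)⟩
  obtain ⟨z₀, -, huniq⟩ := (existsUnique_mem_oracleG K d).1 (lv K d i + 1) (Nat.succ_pos _)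
  exact (huniq z ⟨hz, hl⟩).trans (huniq _ ⟨hmem, length_stAdd K d i⟩).symm

/-- **The final `G` agrees with the stage-`i` filling on every length `≤ Nᵢ₊₁` other than the fresh
one.** [cite: Ko1989, §3 (p. 11)] -/
theorem mem_oracleG_iff_of_le {i : ℕ} {z : List Bool} (hz : z.length ≤ (stage K d (i + 1)).N)
    (hne : z.length ≠ lv K d i + 1) :
    z ∈ oracleG K d ↔ z ∈ fill (↑(stage K d i).B : Set (List Bool)) := by
  have hB : ∀ s : List Bool, s.length = z.length → (s ∈ chosen K d ↔ s ∈ (stage K d i).B) := by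
    intro s hs
    rw [mem_chosen_iff_of_le K d (hs ▸ hz), mem_stage_succ_iff]
    constructor
    · rintro (h | h)
      · exact h
      · rw [h, length_stAdd] at hs; exact absurd hs.symm hne
    · exact Or.inl
  simp only [oracleG, mem_fill_iff, Finset.mem_coe]
  rw [hB z rfl]
  refine or_congr_right (and_congr_right fun _ => ⟨fun h s hs => ?_, fun h s hs hsl => ?_⟩)
  · exact h s ⟨i, hs⟩
  · exact h s ((hB s hsl).1 hs) hsl

/-- The limit oracle answers the queries of the stage-`i` run as the stage oracle did.
[cite: AroraBarakCC2009, Thm. 3.7 (proof)] [cite: FortnowRogers1999JCSS, proof of Thm. 4.2 (p. 7)] -/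
theorem joinLang_oracleG_apply_of_mem_stQs (i : ℕ) {y : List Bool} (hy : y ∈ stQs K (d i) (stage K d i)) :
    Oracle.ofLanguage (joinLang K (oracleG K d)) y = Oracle.ofLanguage (joinLang K (stG (d i) (stage K d i))) y := by
  refine Oracle.ofLanguage_apply_eq_of_iff ?_
  have hlen := length_le_N_succ_of_mem_stQs K d i hy
  match y, hy, hlen with
  | [], _, _ => simp
  | false :: c, _, _ => simp
  | true :: z, hy, hlen =>
    rw [true_cons_mem_joinLang, true_cons_mem_joinLang]
    change z ∈ oracleG K d ↔ z ∈ fill _ ∧ z.length ≠ stLvl (d i) (stage K d i) + 1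
    rw [List.length_cons] at hlen
    by_cases hzl : z.length = lv K d i + 1
    · -- the fresh length: the stage oracle is empty there, and `G` holds only the unqueried string
      refine ⟨fun hz => ?_, fun h => absurd hzl h.2⟩
      obtain ⟨w, -, hw, hnot⟩ := stAdd_spec K d i
      have := eq_stAdd_of_mem_oracleG K d hz hzl
      rw [hw] at this
      rw [this] at hy
      exact absurd hy hnot
    · rw [mem_oracleG_iff_of_le K d (by omega) hzl]
      exact ⟨fun h => ⟨h, hzl⟩, fun h => h.1⟩

/-- **The run against the limit oracle is the stage run.** [cite: AroraBarakCC2009, Thm. 3.7 (proof)] -/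
theorem run_oracleG_eq (i : ℕ) :
    (d i).1.run (Oracle.ofLanguage (joinLang K (oracleG K d))) ((d i).2.eval (lv K d i)) (ones (lv K d i)) =
      stRes K (d i) (stage K d i) :=
  QuantumComplexity.run_congr (d i).1 fun _ hy => joinLang_oracleG_apply_of_mem_stQs K d i hy

/-- **`testLang G ∉ P^{K ⊕ G}`**, provided `d` lists every (polynomial-time algorithm, polynomial)
pair: the pair `(Mᵢ, qᵢ)` errs on `1ⁿ`, `n = lvᵢ` — the `G`-string of length `n + 1` starts with
the bit contradicting the stage run, which is the true run. [cite: FortnowRogers1999JCSS, proof of Thm. 4.2 (p. 7: "L^C ∉ P^C")] [cite: AroraBarakCC2009, Thm. 3.7 (proof)] -/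
theorem testLang_oracleG_not_mem_PRel
    (hd : {D : OracleAlg Bool × Polynomial ℕ | D.1.IsPolyTime encodingBoolBool} ⊆ Set.range d) :
    testLang (oracleG K d) ∉ PRel (Oracle.ofLanguage (joinLang K (oracleG K d))) := by
  rintro ⟨M, hM, q, hq⟩
  obtain ⟨i, hi⟩ := hd (show (M, q) ∈ {D : OracleAlg Bool × Polynomial ℕ | _} from hM)
  have hM' : (d i).1 = M := by rw [hi]
  have hq' : (d i).2 = q := by rw [hi]
  set n := lv K d i with hn
  have hrun := (hq (ones n)).1
  simp only [List.length_replicate] at hrun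
  rw [← hM', ← hq', run_oracleG_eq K d i] at hrun
  -- `hrun : stRes = some [1ⁿ ∈ testLang G]`; the new string is `b w` with `b = ¬[stRes = some 1]`
  obtain ⟨w, hw, hadd, -⟩ := stAdd_spec K d i
  have hmem : stAdd K (d i) (stage K d i) ∈ oracleG K d :=
    Or.inl ⟨i + 1, (mem_stage_succ_iff K d i _).2 (Or.inr rfl)⟩
  rw [hadd] at hmem
  obtain ⟨hsub, hiff⟩ := existsUnique_witness (existsUnique_mem_oracleG K d).1 (ones n)
  by_cases hres : stRes K (d i) (stage K d i) = some true
  · -- the run accepted, so `b = 0`: `0w ∈ G` and `1ⁿ ∉ testLang G`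
    have hb : stBit K (d i) (stage K d i) = false := by simp [stBit, hres]
    rw [hb] at hmem
    have hnot : ones n ∉ testLang (oracleG K d) :=
      fun h => hiff.1 h ⟨w, by rw [hw, List.length_replicate], hmem⟩
    rw [hres, Option.some.injEq] at hrun
    exact Bool.false_ne_true (((Set.notMem_iff_boolIndicator _ _).1 hnot).symm.trans hrun.symm)
  · -- the run did not accept, so `b = 1`: `1w ∈ G` and `1ⁿ ∈ testLang G`, but the run said `0`
    have hb : stBit K (d i) (stage K d i) = true := by simp [stBit, hres]
    rw [hb] at hmem
    have hin : ones n ∈ testLang (oracleG K d) := ⟨w, by rw [hw, List.length_replicate], hmem⟩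
    rw [(Set.mem_iff_boolIndicator _ _).1 hin] at hrun
    exact hres hrun

/-! ### Summary -/

/-- **The diagonal oracle, packaged.** For every language `K` there is `G ⊆ {0,1}*` with exactly
one string of every positive length and none of length `0`, such that
`testLang G = {x | ∃ w, |w| = |x| ∧ 1w ∈ G}` is not in `P^{K ⊕ G}` — while its verifiers
`vLang b (K ⊕ G)` are (`vLang_mem_PRel`, `boolPair_mem_vLang_joinLang`, `existsUnique_witness`).
[cite: FortnowRogers1999JCSS, Thm. 4.2 and its proof (p. 7)] -/
theorem exists_oracleG (K : Set (List Bool)) :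
    ∃ G : Set (List Bool), (∀ n, 0 < n → ∃! z, z ∈ G ∧ z.length = n) ∧ ([] : List Bool) ∉ G ∧
      testLang G ∉ PRel (Oracle.ofLanguage (joinLang K G)) := by
  obtain ⟨d, hd⟩ := BGS.exists_enum_pair
  exact ⟨oracleG K d, (existsUnique_mem_oracleG K d).1, (existsUnique_mem_oracleG K d).2,
    testLang_oracleG_not_mem_PRel K d hd⟩

end UPDiag

end Literature.Computability.Complexity
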